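import Summits.NavierStokesRegularity.NavierStokesRegularity.Theorems.ExtremalBiaxialitySubcritical.Negative.ExactStrainFlows

/-!
# Crux `ExtremalBiaxialitySubcritical` (stmt-NavierStokesRegularity-11609), negative side:
# Leray's backward self-similar linear strain — every point a record

Route `SqueezeCycle`, crux
`Summit.NavierStokesRegularity.NavierStokesRegularity.Theses.SqueezeCycle.ExtremalBiaxialitySubcritical`.
Companion of `Negative/ExactStrainFlows` (cdisprove adversary, generation 2, D-0016): the amplitude
`c(t) = m/(−t)` in `ampStrain` gives `u(t, x) = (m/(−t))(x₀, x₁, −2x₂) = (−t)^{−1/2} U(x/√(−t))`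
with the LINEAR profile `U(y) = m·diag(1,1,−2)·y` — an exact solution of Leray's backward
self-similar profile equation `−ΔU + ½U + ½y·∇U + (U·∇)U + ∇P = 0`
(`ΔU = 0`, `½U + ½y·∇U = U`, `P = −½ m yᵀDy − ½ m²|Dy|²`), hence an exact classical Navier–Stokes
flow on `ℝ³ × (−∞, 0)` (`isClassicalNSSolutionOn_selfSimilarStrain`), singular at `t = 0`,
discretely self-similar for EVERY factor, and with Leray-gauge middle strain eigenvalue
`Λ ≡ m` on all of `ℝ³ × (−∞, 0)` (`selfSimilarStrain_lamGE` / `selfSimilarStrain_lamLE`, the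
crux's two-frame clauses verbatim): every space-time point is a record of any prescribed size.
The purest "perpetual squeeze machine"; it is excluded from the Type-I class `𝒦_C` only by its
linear growth (the self-similar exclusions of Nečas–Růžička–Šverák 1996 / Tsai 1998, barrier
`LeraySelfSimilarBlowupExclusion`, concern `L³` / decaying profiles). Consequently no argument
that sees only the profile equation near a point, the DSS/recurrence structure of records, or
optimality along the flow can bound `m`.
-/

noncomputable section

open Set Function Filter MeasureTheory InnerProductSpace
open scoped RealInnerProductSpace ContDiff

namespace Summit.NavierStokesRegularity.NavierStokesRegularity.Theorems.ExtremalBiaxialitySubcritical.Negative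

open Literature.Analysis.FluidPDE

/-- **Leray's backward self-similar biaxial strain** `u(t, x) = (m/(−t))(x₀, x₁, −2x₂)`. [folklore] -/
def selfSimilarStrain (m : ℝ) : ℝ → EuclideanSpace ℝ (Fin 3) → EuclideanSpace ℝ (Fin 3) :=
  ampStrain fun t => m * (-t)⁻¹

/-- Its pressure (`c' = m/t²`). [folklore] -/
def selfSimilarPressure (m : ℝ) : ℝ → EuclideanSpace ℝ (Fin 3) → ℝ :=
  ampPressure (fun t => m * (-t)⁻¹) fun t => m * ((-t)⁻¹ * (-t)⁻¹)

/-- `d/dt (m/(−t)) = m/t²` for `t < 0`. [folklore] -/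
theorem hasDerivAt_selfSimilarAmp (m : ℝ) {t : ℝ} (ht : t < 0) :
    HasDerivAt (fun t => m * (-t)⁻¹) (m * ((-t)⁻¹ * (-t)⁻¹)) t := by
  have h := ((hasDerivAt_neg t).inv (by linarith : -t ≠ 0)).const_mul m
  rw [neg_neg, one_div, sq, mul_inv] at h
  exact h

/-- `(−t)·(m/(−t)) = m` for `t < 0`: the gauge weight exactly cancels the amplitude. [folklore] -/
theorem neg_mul_selfSimilarAmp (m : ℝ) {t : ℝ} (ht : t < 0) : (-t) * (m * (-t)⁻¹) = m := by
  rw [mul_comm m, ← mul_assoc, mul_inv_cancel₀ (neg_pos.2 ht).ne', one_mul]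

/-- **The self-similar strain is an exact classical Navier–Stokes flow on `ℝ³ × (−∞, 0)`**
(viscosity `1`, no force). [folklore] -/
theorem isClassicalNSSolutionOn_selfSimilarStrain (m : ℝ) :
    IsClassicalNSSolutionOn (Set.Iio 0) 1 0 (selfSimilarStrain m) (selfSimilarPressure m) := by
  have hinv : ContDiffOn ℝ ∞ (fun t : ℝ => (-t)⁻¹) (Set.Iio 0) :=
    contDiffOn_id.neg.inv fun t ht => by simp only [Set.mem_Iio] at ht; exact (neg_pos.2 ht).ne'
  exact isClassicalNSSolutionOn_ampStrain (uniqueDiffOn_Iio 0)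
    (fun t ht => hasDerivAt_selfSimilarAmp m ht) (contDiffOn_const.mul hinv)
    (contDiffOn_const.mul (hinv.mul hinv))

/-- **`Λ ≡ m`, lower half**: the crux's lower two-frame clause with value `m` at EVERY `(t, x)`,
`t < 0`. [folklore] -/
theorem selfSimilarStrain_lamGE (m : ℝ) {t : ℝ} (ht : t < 0) (x : EuclideanSpace ℝ (Fin 3)) :
    ∃ v w : EuclideanSpace ℝ (Fin 3), ‖v‖ = 1 ∧ ‖w‖ = 1 ∧ inner ℝ v w = 0 ∧ ∀ α β : ℝ,
      m * (α ^ 2 + β ^ 2) ≤ (-t) *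
        inner ℝ (fderiv ℝ (selfSimilarStrain m t) x (α • v + β • w)) (α • v + β • w) := by
  have h := ampStrain_lamGE (fun t => m * (-t)⁻¹) t x
  rw [neg_mul_selfSimilarAmp m ht] at h
  exact h

/-- **`Λ ≡ m`, upper half**: the crux's upper two-frame clause with value `m` at EVERY `(t, x)`,
`t < 0` (`m ≥ 0`). Every space-time point of this exact flow is a record: the attained value is
self-maximal, orbit-maximal, recurrent under every rescaling, and `m` is arbitrary. [folklore] -/
theorem selfSimilarStrain_lamLE {m : ℝ} (hm : 0 ≤ m) {t : ℝ} (ht : t < 0)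
    (x : EuclideanSpace ℝ (Fin 3)) :
    ∃ v w : EuclideanSpace ℝ (Fin 3), ‖v‖ = 1 ∧ ‖w‖ = 1 ∧ inner ℝ v w = 0 ∧ ∀ α β : ℝ,
      (-t) * inner ℝ (fderiv ℝ (selfSimilarStrain m t) x (α • v + β • w)) (α • v + β • w) ≤
        m * (α ^ 2 + β ^ 2) :=
  ampStrain_lamLE _ hm (neg_mul_selfSimilarAmp m ht).le x

/-- **The self-similar strain scales into itself**: `λ u(λ²t, λx) = u(t, x)` for every `λ ≠ 0`
(discrete — indeed continuous — self-similarity about the origin of space-time). [folklore] -/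
theorem selfSimilarStrain_scale (m : ℝ) {c : ℝ} (hc : c ≠ 0) (t : ℝ) (x : EuclideanSpace ℝ (Fin 3)) :
    c • selfSimilarStrain m (c ^ 2 * t) (c • x) = selfSimilarStrain m t x := by
  ext i
  fin_cases i <;> (simp [selfSimilarStrain, ampStrain, linearStrain]; field_simp)

end Summit.NavierStokesRegularity.NavierStokesRegularity.Theorems.ExtremalBiaxialitySubcritical.Negative

end
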